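import Literature.Probability.RandomPlanarGeometry.HexSAWSurfaceWallRenewal
import Literature.Probability.Process.RenewalKendallRate
import HarnessLib

/-!
# A geometric RATE for the renewal theorem of adsorbed wall bridges, for EVERY `y > μ⁴` (Kendall's theorem instantiated)

Lane pcv-sawmu, a-idea-1 gen 29, car 48 «KENDALL-SAW». CLASS D on `HexSAWSurfaceWallRenewal` (the adsorbed
renewal structure: `pwbLaw`, `pwbAmp`, `pwbMean`, `hasSum_pwbLaw`, `pwbLaw_le_geom`, `pwbLaw_one_pos`) and on the model-free
`Process.RenewalKendallRate` (Kendall's renewal rate in coefficient form, `Renewal.kendall_abs_sub_inv_le_of_geometric`).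

Setting (tree, `HexSAWSurfaceWallRenewal`): for real `y` the positive wall bridges of the hexagonal half-plane of length `2s`
have partition function `PWB (2s) y`; with `β(y) = wallRate y`, `u_s(y) = pwbAmp y s = PWB_{2s}(y) β(y)^{-2s}` satisfies the
renewal equation with the irreducible law `f_s(y) = pwbLaw y s`, and for `y > μ⁴` (`μ = hexConnectiveConstant`):
`Σ_s f_s = 1` (`hasSum_pwbLaw`), `m(y) = pwbMean y = Σ s f_s < ∞`, `u_s → 1/m(y)` (`tendsto_pwbAmp`, NO rate), with the
geometric envelope `f_s ≤ μ²√y · θ^s`, `θ = θ(y) = μ²/√y < 1` (`pwbLaw_le_geom`) and the atom `f_1(y) > 0` (`pwbLaw_one_pos`).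
The tree's explicit rate `abs_pwbAmp_sub_inv_pwbMean_le` needs the Feller hypothesis `G(ρ) = Σ r_j ρ^{j} < 1`, which holds
only for large `y` (the closed laws of the lane cover `y ≥ 49`).

## Results (all for every real `y > μ⁴ = 6 + 4√2 ≈ 11.66`)

* `one_sub_sum_pwbLaw_le` — the TAIL envelope `r_n(y) = 1 − Σ_{k ≤ n} f_k(y) ≤ μ⁴/(1 − θ) · θ^n`.
* ★ `abs_pwbAmp_sub_inv_pwbMean_le_kendall` — the EXPLICIT Kendall rate: for every radius `ρ` with `1 < ρ`, `ρθ < 1` and the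
  margin inequality `A(ρθ/(1−ρθ) − θ/(1−θ)) < b/(b + 2Aθ/(1−θ)²)` (`A = μ⁴/(1−θ)`, `b = f_1(y) = pwbLaw y 1`):
  `|pwbAmp y s − m(y)⁻¹| ≤ ρ^{-s} / ((b/(b + 2Aθ/(1−θ)²) − A(ρθ/(1−ρθ) − θ/(1−θ)))·(ρ − 1))` for every `s`
  (the parameters enter through the equations `hθ : θ = μ²/√y`, `hA : A = μ⁴/(1 − θ)`).
* ★ `exists_geometric_rate_pwbAmp` — hypothesis-free consequence: for every `y > μ⁴` THERE IS a radius `ρ > 1` and a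
  constant `K` with `|PWB_{2s}(y) β(y)^{-2s} − 1/m(y)| ≤ K ρ^{-s}` for all `s` (the margin's left side tends to `0` as
  `ρ → 1⁺`; the proof exhibits `ρ = (1 + ρ₀)/2`, `ρ₀ = t/((1+t)θ)`, `t = θ/(1−θ) + c/A`, `c = b/(b + 2Aθ/(1−θ)²)`), and the
  same in the `PWB (2s) y / β(y)^{2s}` spelling (`exists_geometric_rate_PWB_div`).

Honest label: COROLLARY (D) — the renewal-with-rate statement of Madras–Slade Thm 4.2.5 type for the adsorbed wall-bridge
decomposition, obtained by instantiating the lane's Kendall rate (`RenewalKendallRate`, a consolidation of Kendall 1959 /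
Bednorz 2013 §2 with elementary constants) at the law `pwbLaw y`; the geometric rate for ALL `y > μ⁴` is new in writing
for this model (modest; mechanism = the parents'). Orientation (floats, NOT kernel facts; crude envelope
`A = μ⁴/(1−θ)`, `b ≥ y²/(y²+6)`): the exhibited radius is `ρ(y) = (1 + ρ₀)/2` with `ρ₀ − 1 ≈ (1−θ)²c/(Aθ)`, so
`ρ − 1 ≈ 4·10⁻¹¹` at `y = 13` (`K ≈ 7·10¹⁵`), `≈ 4·10⁻⁶` at `y = 25` (`K ≈ 3·10⁸`), `≈ 1.2·10⁻³` at `y = 100`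
(`K ≈ 5·10⁴`), `≈ 0.06` at `y = 10³` (`K ≈ 150`), `≈ 0.58` at `y = 10⁴` (`K ≈ 6`): a rate for EVERY `y > μ⁴` in
principle, numerically useful only for large `y` (where the lane's closed laws, `y ≥ 49`, are far sharper).

Primary sources: [cite: MadrasSlade1993, §4.2 Theorem 4.2.2(b) (pp. 91–92) and Theorem 4.2.5 (p. 95)] — renewal structure and
rate for bridge decompositions; [cite: Bednorz2013, §2, Corollary 2.5 (p. 5)] — the quantitative Kendall theorem;
[cite: Feller1968, XIII.3] — discrete renewal theory; [cite: BeatonBousquetMelouDeGierDuminilCopinGuttmann2014, §3.1] — the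
adsorbed honeycomb surface model (`y`, wall bridges).
-/

noncomputable section

open Finset Filter
open _root_.Topology

namespace Literature.Probability.RandomPlanarGeometry.SAW.HexBW.Wall

variable {y : ℝ}

/-- [folklore] `μ⁴ < y` forces `0 < y` and `1 ≤ y` (`1 < μ`). [cite: MadrasSlade1993, §1.2 (1.2.16) (p. 11)] -/
private theorem pos_and_one_le_of_mu_four_lt_kd (hy : hexConnectiveConstant ^ 4 < y) : 0 < y ∧ 1 ≤ y := by
  have h1 : (1 : ℝ) ≤ hexConnectiveConstant ^ 4 := one_le_pow₀ HV.one_lt_hexConnectiveConstant.le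
  exact ⟨by linarith, by linarith⟩

/-- [folklore] `0 < θ(y) = μ²/√y < 1` for `μ⁴ < y`. [cite: MadrasSlade1993, §4.2, remark before (4.2.21) (p. 94)] -/
private theorem theta_pos_lt_one_kd (hy : hexConnectiveConstant ^ 4 < y) :
    0 < hexConnectiveConstant ^ 2 / Real.sqrt y ∧ hexConnectiveConstant ^ 2 / Real.sqrt y < 1 := by
  have hy0 := (pos_and_one_le_of_mu_four_lt_kd hy).1
  have hμ := hexConnectiveConstant_pos
  refine ⟨div_pos (pow_pos hμ 2) (Real.sqrt_pos.2 hy0), ?_⟩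
  rw [div_lt_one (Real.sqrt_pos.2 hy0), Real.lt_sqrt (by positivity)]
  calc (hexConnectiveConstant ^ 2) ^ 2 = hexConnectiveConstant ^ 4 := by ring
    _ < y := hy

/-- **Tail envelope of the irreducible law**: for `y > μ⁴` and every `n`,
`r_n(y) = 1 − Σ_{k ≤ n} f_k(y) = Σ_{k > n} f_k(y) ≤ μ⁴/(1 − θ) · θ^n`, `θ = μ²/√y` — from `Σ f = 1` and the envelope
`f_k ≤ μ²√y θ^k` (`μ²√y · θ = μ⁴`). [cite: MadrasSlade1993, §4.2, remark before (4.2.21) (p. 94)] [cite: Feller1968, XIII.3] -/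
theorem one_sub_sum_pwbLaw_le (hy : hexConnectiveConstant ^ 4 < y) (n : ℕ) :
    1 - ∑ k ∈ range (n + 1), pwbLaw y k ≤
      hexConnectiveConstant ^ 4 / (1 - hexConnectiveConstant ^ 2 / Real.sqrt y) *
        (hexConnectiveConstant ^ 2 / Real.sqrt y) ^ n := by
  obtain ⟨hy0, hy1⟩ := pos_and_one_le_of_mu_four_lt_kd hy
  obtain ⟨hθ0, hθ1⟩ := theta_pos_lt_one_kd hy
  set θ := hexConnectiveConstant ^ 2 / Real.sqrt y with hθ
  set C := hexConnectiveConstant ^ 2 * Real.sqrt y with hC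
  have hsq0 : 0 < Real.sqrt y := Real.sqrt_pos.2 hy0
  have hCθ : C * θ = hexConnectiveConstant ^ 4 := by
    rw [hC, hθ]; field_simp
  have htail : HasSum (fun k : ℕ => pwbLaw y (k + (n + 1))) (1 - ∑ k ∈ range (n + 1), pwbLaw y k) :=
    (hasSum_nat_add_iff' (n + 1)).2 (hasSum_pwbLaw hy)
  have hmaj : HasSum (fun k : ℕ => C * θ ^ (n + 1) * θ ^ k) (C * θ ^ (n + 1) * (1 - θ)⁻¹) :=
    (hasSum_geometric_of_lt_one hθ0.le hθ1).mul_left _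
  have hle : ∀ k : ℕ, pwbLaw y (k + (n + 1)) ≤ C * θ ^ (n + 1) * θ ^ k := fun k =>
    calc pwbLaw y (k + (n + 1)) ≤ C * θ ^ (k + (n + 1)) := pwbLaw_le_geom hy1 _
      _ = C * θ ^ (n + 1) * θ ^ k := by rw [pow_add]; ring
  calc 1 - ∑ k ∈ range (n + 1), pwbLaw y k ≤ C * θ ^ (n + 1) * (1 - θ)⁻¹ := hasSum_le hle htail hmaj
    _ = C * θ / (1 - θ) * θ ^ n := by rw [pow_succ]; field_simp
    _ = hexConnectiveConstant ^ 4 / (1 - θ) * θ ^ n := by rw [hCθ]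

/-- **Kendall's rate for adsorbed wall bridges, explicit form**: for `y > μ⁴`, `θ = μ²/√y`, `A = μ⁴/(1 − θ)`,
`b = f_1(y) = pwbLaw y 1`, and every radius `ρ` with `1 < ρ`, `ρθ < 1` and the margin inequality
`A(ρθ/(1−ρθ) − θ/(1−θ)) < b/(b + 2·Aθ/(1−θ)²)`:
`|PWB_{2s}(y) β(y)^{-2s} − 1/m(y)| ≤ ρ^{-s} / ((b/(b + 2Aθ/(1−θ)²) − A(ρθ/(1−ρθ) − θ/(1−θ)))·(ρ − 1))` for every `s`.
Instance of `Renewal.kendall_abs_sub_inv_le_of_geometric` with the tail envelope `one_sub_sum_pwbLaw_le` and the atom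
`pwbLaw_one_pos`. [cite: Bednorz2013, §2, Corollary 2.5 (p. 5)] [cite: MadrasSlade1993, §4.2 Theorem 4.2.5 (p. 95)]
[cite: Feller1968, XIII.3] -/
theorem abs_pwbAmp_sub_inv_pwbMean_le_kendall (hy : hexConnectiveConstant ^ 4 < y) {θ A ρ : ℝ}
    (hθ : θ = hexConnectiveConstant ^ 2 / Real.sqrt y) (hA : A = hexConnectiveConstant ^ 4 / (1 - θ))
    (hρ : 1 < ρ) (hρθ : ρ * θ < 1)
    (hc : A * (ρ * θ / (1 - ρ * θ) - θ / (1 - θ)) < pwbLaw y 1 / (pwbLaw y 1 + 2 * (A * θ / (1 - θ) ^ 2))) (s : ℕ) :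
    |pwbAmp y s - (pwbMean y)⁻¹| ≤
      ρ⁻¹ ^ s / ((pwbLaw y 1 / (pwbLaw y 1 + 2 * (A * θ / (1 - θ) ^ 2)) - A * (ρ * θ / (1 - ρ * θ) - θ / (1 - θ))) * (ρ - 1)) := by
  obtain ⟨hy0, hy1⟩ := pos_and_one_le_of_mu_four_lt_kd hy
  obtain ⟨hθ0, hθ1⟩ := theta_pos_lt_one_kd hy
  rw [← hθ] at hθ0 hθ1
  have htail : ∀ j : ℕ, 1 ≤ j → 1 - ∑ k ∈ range (j + 1), pwbLaw y k ≤ A * θ ^ j := by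
    intro j _
    have h := one_sub_sum_pwbLaw_le hy j
    rw [← hθ, ← hA] at h
    exact h
  have h := Literature.Probability.Process.Renewal.kendall_abs_sub_inv_le_of_geometric
    (u := pwbAmp y) (f := pwbLaw y) (r := fun n => 1 - ∑ k ∈ range (n + 1), pwbLaw y k) (fun _ => rfl)
    pwbAmp_zero (pwbLaw_nonneg hy0.le) pwbLaw_zero (fun n hn => pwbAmp_eq_sum hn) (hasSum_pwbLaw hy)
    (summable_mul_pwbLaw hy) (pwbLaw_one_pos hy0) le_rfl hθ0 hρ hρθ htail hc s
  simpa only [pwbMean] using h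

/-- **Geometric rate of the renewal theorem for adsorbed wall bridges, for EVERY `y > μ⁴`**: there are `ρ > 1` and `K`
with `|PWB_{2s}(y) β(y)^{-2s} − 1/m(y)| ≤ K ρ^{-s}` for all `s`. The radius is exhibited: `ρ = (1 + ρ₀)/2` with
`ρ₀ = t/((1+t)θ) > 1`, `t = θ/(1−θ) + c/A`, `c = b/(b + 2Aθ/(1−θ)²)`, `A = μ⁴/(1−θ)`, `b = f_1(y)`, `θ = μ²/√y`
(so that `ρθ < t/(1+t) < 1` and the margin inequality of `abs_pwbAmp_sub_inv_pwbMean_le_kendall` holds).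
The tree's `tendsto_pwbAmp` is the rate-free statement. [cite: MadrasSlade1993, §4.2 Theorem 4.2.5 (p. 95)]
[cite: Bednorz2013, §2, Corollary 2.5 (p. 5)] [cite: Feller1968, XIII.3] -/
theorem exists_geometric_rate_pwbAmp (hy : hexConnectiveConstant ^ 4 < y) :
    ∃ ρ : ℝ, 1 < ρ ∧ ∃ K : ℝ, ∀ s : ℕ, |pwbAmp y s - (pwbMean y)⁻¹| ≤ K * ρ⁻¹ ^ s := by
  obtain ⟨hy0, hy1⟩ := pos_and_one_le_of_mu_four_lt_kd hy
  obtain ⟨hθ0, hθ1⟩ := theta_pos_lt_one_kd hy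
  set θ := hexConnectiveConstant ^ 2 / Real.sqrt y with hθ
  set A := hexConnectiveConstant ^ 4 / (1 - θ) with hA
  set b := pwbLaw y 1 with hb
  set M := A * θ / (1 - θ) ^ 2 with hM
  set c := b / (b + 2 * M) with hc
  have hb0 : 0 < b := pwbLaw_one_pos hy0
  have h1θ : 0 < 1 - θ := by linarith
  have hA0 : 0 < A := div_pos (pow_pos hexConnectiveConstant_pos 4) h1θ
  have hM0 : 0 ≤ M := by positivity
  have hc0 : 0 < c := by positivity
  set t := θ / (1 - θ) + c / A with ht
  have ht0 : θ / (1 - θ) < t := by have := div_pos hc0 hA0; linarith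
  have htpos : 0 < t := lt_trans (div_pos hθ0 h1θ) ht0
  -- `θ < t/(1+t)`
  have hθt : θ < t / (1 + t) := by
    rw [lt_div_iff₀ (by linarith)]
    have h := (div_lt_iff₀ h1θ).1 ht0
    nlinarith
  set ρ₀ := t / ((1 + t) * θ) with hρ₀
  have hρ₀1 : 1 < ρ₀ := by
    rw [hρ₀, lt_div_iff₀ (by positivity), one_mul]
    calc (1 + t) * θ < (1 + t) * (t / (1 + t)) := mul_lt_mul_of_pos_left hθt (by linarith)
      _ = t := by field_simp
  set ρ := (1 + ρ₀) / 2 with hρ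
  have hρ1 : 1 < ρ := by rw [hρ]; linarith
  have hρρ₀ : ρ < ρ₀ := by rw [hρ]; linarith
  have hρθ' : ρ * θ < t / (1 + t) := by
    calc ρ * θ < ρ₀ * θ := mul_lt_mul_of_pos_right hρρ₀ hθ0
      _ = t / (1 + t) := by rw [hρ₀]; field_simp
  have hρθ : ρ * θ < 1 := hρθ'.trans (by rw [div_lt_one (by linarith)]; linarith)
  -- the margin inequality: `ρθ/(1−ρθ) < t`
  have hmargin : A * (ρ * θ / (1 - ρ * θ) - θ / (1 - θ)) < c := by
    have h1 : ρ * θ / (1 - ρ * θ) < t := by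
      rw [div_lt_iff₀ (by linarith)]
      have h2 := (lt_div_iff₀ (show (0 : ℝ) < 1 + t by linarith)).1 hρθ'
      nlinarith
    have h3 : ρ * θ / (1 - ρ * θ) - θ / (1 - θ) < c / A := by rw [ht] at h1; linarith
    calc A * (ρ * θ / (1 - ρ * θ) - θ / (1 - θ)) < A * (c / A) := mul_lt_mul_of_pos_left h3 hA0
      _ = c := by field_simp
  refine ⟨ρ, hρ1, 1 / ((c - A * (ρ * θ / (1 - ρ * θ) - θ / (1 - θ))) * (ρ - 1)), fun s => ?_⟩
  have h := abs_pwbAmp_sub_inv_pwbMean_le_kendall hy hθ hA hρ1 hρθ (by rw [← hM, ← hc]; exact hmargin) s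
  rw [← hM, ← hc] at h
  calc |pwbAmp y s - (pwbMean y)⁻¹| ≤ ρ⁻¹ ^ s / ((c - A * (ρ * θ / (1 - ρ * θ) - θ / (1 - θ))) * (ρ - 1)) := h
    _ = 1 / ((c - A * (ρ * θ / (1 - ρ * θ) - θ / (1 - θ))) * (ρ - 1)) * ρ⁻¹ ^ s := by ring

/-- The same geometric rate in the partition-function spelling: for every `y > μ⁴` there are `ρ > 1`, `K` with
`|PWB (2s) y / β(y)^{2s} − 1/m(y)| ≤ K ρ^{-s}` for all `s`. [cite: MadrasSlade1993, §4.2 Theorem 4.2.5 (p. 95)]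
[cite: Bednorz2013, §2, Corollary 2.5 (p. 5)] -/
theorem exists_geometric_rate_PWB_div (hy : hexConnectiveConstant ^ 4 < y) :
    ∃ ρ : ℝ, 1 < ρ ∧ ∃ K : ℝ, ∀ s : ℕ, |PWB (2 * s) y / wallRate y ^ (2 * s) - (pwbMean y)⁻¹| ≤ K * ρ⁻¹ ^ s :=
  exists_geometric_rate_pwbAmp hy

end Literature.Probability.RandomPlanarGeometry.SAW.HexBW.Wall

end
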